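import Literature.AnabelianGeometry.EtaleTheta.TemperedFrobenioidOfRankOneObject
import Literature.AnabelianGeometry.EtaleTheta.Discharge.Sec4BaseRootLawAtKummerTateTower
import Literature.AnabelianGeometry.EtaleTheta.Discharge.Sec3Prop34ConstTateTower
import HarnessLib

/-!
# [EtTh] Def. 3.6 (ii) at the v2 MODEL OF RECORD: the Kummer–Tate tower's base point is a RANK-ONE OBJECT of
# `DivisorMonoids.ofTower TateTowerKummer.tower`, and the tempered Frobenioid over it (weak vocabulary, `Λ = ℤ`)

S. Mochizuki, *The étale theta function and its Frobenioid-theoretic manifestations*, Publ. RIMS **45** (2009), Def. 3.3 (iii)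
p.73 (`Φ₀`, `B₀`, `div₀`; Rmk. 3.3.1: the primes of `Φ₀(Y)` are the Galois orbits of prime log-divisors), Def. 3.6 (i)(ii) pp.76–77
[cite: MochizukiEtTh2009, Def 3.6 p.77]; S. Mochizuki, *The geometry of Frobenioids II* (2008), Ex. 1.1 (the `p`-adic Frobenioid)
[cite: MochizukiFrdII2008, Ex. 1.1 p.408].

abc-iut cell, layer L2, seat abc-iut-L2-d2 (gen 5); abc-iut-L2-lead **R587 (a)** «re-key of the rank-one constructor to a v2 base»
(memo `VNEXT-V2-RealifiedChain-L2d2.md` §2).  CLASS (b) MODEL / NON-VACUITY construction (defs + theorems; 0 instances /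
notation / `Prop` facts; flagged to ref-d).  The re-key needs NO new engine: abc-iut-w5-d179's `dm`-GENERIC rank-one engine
`TemperedFrobenioid.ofRankOneObject (P : dm.RankOneObject)` (`TemperedFrobenioidOfRankOneObject.lean`, itself the `dm`-generic form
of abc-iut-w6-d048's `ofRankOnePoint`) applies to the v2 datum `dm := DivisorMonoids.ofTower TateTowerKummer.tower` of
abc-iut-L2-t3 (Def. 3.3 (iii) with covering-indexed `Mero` over print's base `B^temp(Grp)⁰`, `LogDivisorTower.lean` /
`LogDivisorModelTateTowerKummer.lean`) as soon as a rank-one OBJECT of that datum is exhibited — which this file does: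

* `TateTowerKummer.pt` — the one-point connected tempered covering `Grp/Grp` (abc-iut-L2-t3's `quotCover ⊤`), `s₀` its point;
  since EVERY level of the tower is abc-iut-w6-d058's skeleton with `Grp` acting through `γ` (`act = TateTower.action.comap fst`),
  `Φ₀(pt) = act.phiZero (gset pt)` = the translation-invariant effective log-divisors of the chain = `{n·Σ_j [F_j]}`:
  `constPhi`, `val_apply_inr_eq`, `multAt`, `eq_constPhi_multAt`, **`phiZeroPtEquivNat : act.phiZero (gset pt) ≃* ℕ`**
  (abc-iut-w6-d048's `TateTowerFrd.phiZeroTopEquivNat`, re-keyed to the `Grp`-action);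
* `cnstFn c ∈ B₀(pt)` (the constant `ϖ^c`), `cnstFn_mem_fZero`, `div₀_cnstFn : div₀(ϖⁿ) = n·Σ_j [F_j]`;
* **`TateTowerKummer.rankOneObject : (DivisorMonoids.ofTower tower).RankOneObject`** and
  **`TateTowerKummer.temperedFrobenioid R S := TemperedFrobenioid.ofRankOneObject rankOneObject hpf R S`** — a tempered Frobenioid
  (Def. 3.6 (ii), weak vocabulary of record, monoid type `ℤ`) over the v2 MODEL OF RECORD, `hpf` = abc-iut-L2-t3's
  `TateTowerKummer.hpf`; `nonempty_temperedFrobenioid_ofTower`, `isFrobenioid_temperedFrobenioid` ([FrdI] Thm. 5.2 (ii)), and the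
  re-based witness over print's genuine base `B^temp(Π)⁰` for every `Π` (`nonempty_temperedFrobenioid_ofTower_connectedPart`).

HONEST LABEL: genuine weak vocabularies and CONSTRUCTED data (the Kummer–Tate tower, where ERRATUM E2's root law and non-degeneracy
coexist, abc-iut-L2-t3 `rootLaw_and_nondegenerate`); `D` one object over the one-point covering — an instantiation witness, not the
tempered Frobenioid of a Tate curve; the `Λ = ℝ` engine (`ofRankOnePointR`) has no `dm`-generic twin yet (memo §2).  Nothing here
bears on [IUTchIII] Cor. 3.12; no side taken; typed ≠ proved for anything else.
-/

noncomputable section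

namespace Literature.AnabelianGeometry.EtaleTheta

open CategoryTheory Opposite Function Literature.AlgebraicGeometry.Frobenioids Literature.AnabelianGeometry.SemiGraphs
  LogDivisorModel LogDivisorModel.GaloisAction LogDivisorModel.TateTower LogDivisorTower

namespace TateTowerKummer

open TateTowerFrd

/-! ### The one-point covering `Grp/Grp` and its log-divisors -/

/-- **The base point of the v2 model of record**: the one-point connected tempered covering `Grp/Grp` (= the Tate curve `X` itself).
[cite: MochizukiFrdII2008, Ex 1.3 (ii) p.11] -/
def pt : ConnectedPart (BTemp Grp) := quotCover ⊤ isOpen_univ 0 le_top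

/-- The point of `Grp/Grp`. [cite: MochizukiEtTh2009, Def 3.3 p.73] -/
def s₀ : (gset pt).V := ((1 : Grp) : Grp ⧸ (⊤ : Subgroup Grp))

/-- All points of `Grp/Grp` coincide. [cite: MochizukiEtTh2009, Def 3.3 p.73] -/
theorem eq_s₀ (s : (gset pt).V) : s = s₀ := by
  change @Eq (Grp ⧸ (⊤ : Subgroup Grp)) s s₀
  obtain ⟨a, rfl⟩ := QuotientGroup.mk_surjective s
  exact QuotientGroup.eq.mpr (Subgroup.mem_top _)

/-- `Grp` translates the chain's log-divisors through `γ`. [cite: MochizukiEtTh2009, Def 3.3 (iii) p.73] -/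
theorem act_actDIV_apply (g : Grp) (d : TateTower.model.DIV) : act.actDIV g d = shiftDIV (Multiplicative.toAdd g.1) d := rfl

/-- The constant effective log-divisor `n·Σ_j [F_j]` as an element of `Φ₀(Grp/Grp)` (translation-invariant).
[cite: MochizukiEtTh2009, Def 3.3 p.73] -/
def constPhi (n : ℕ) : act.phiZero (gset pt) :=
  ⟨fun _ => constDIV n, fun _ => constDIV_mem_Divplus n, fun g _ => by
    rw [act_actDIV_apply, shiftDIV_constDIV]⟩

/-- A `Grp`-invariant log-divisor takes the same value on every component (translate by `γⁿ`). [cite: MochizukiEtTh2009, Def 3.3 p.73] -/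
theorem val_apply_inr_eq (φ : act.phiZero (gset pt)) (s : (gset pt).V) (n : ℤ) :
    val (φ.1 s) (Sum.inr n) = val (φ.1 s₀) (Sum.inr 0) := by
  have h := φ.2.2 ((Multiplicative.ofAdd n, 1) : Grp) s
  rw [eq_s₀ ((gset pt).ρ ((Multiplicative.ofAdd n, 1) : Grp) s), eq_s₀ s] at h
  have h' := congrArg (fun d : Multiplicative (TateTower.Idx → ℤ) => val d (Sum.inr n)) h
  change val (φ.1 s₀) (Sum.inr n) =
    Multiplicative.toAdd (shiftDIV (Multiplicative.toAdd (Multiplicative.ofAdd n)) (φ.1 s₀)) (Sum.inr n) at h'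
  rw [toAdd_shiftDIV, toAdd_ofAdd, shiftIdx_symm_inr, sub_self] at h'
  rw [eq_s₀ s]
  exact h'

/-- The multiplicity of `φ ∈ Φ₀(Grp/Grp)` along (any) component. [cite: MochizukiEtTh2009, Def 3.3 p.73] -/
def multAt (φ : act.phiZero (gset pt)) : ℕ := Int.toNat (val (φ.1 s₀) (Sum.inr 0))

/-- `φ = (multAt φ)·Σ_j [F_j]`. [cite: MochizukiEtTh2009, Def 3.3 p.73] -/
theorem eq_constPhi_multAt (φ : act.phiZero (gset pt)) : φ = constPhi (multAt φ) := by
  refine Subtype.ext (funext fun s => Multiplicative.toAdd.injective (funext fun x => ?_))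
  rcases x with c | n
  · exact c.elim
  · have h0 : (0 : ℤ) ≤ val (φ.1 s₀) (Sum.inr 0) := (φ.2.1 s₀).2 (Sum.inr 0)
    change val (φ.1 s) (Sum.inr n) = val (constDIV ((multAt φ : ℕ) : ℤ)) (Sum.inr n)
    rw [val_constDIV, val_apply_inr_eq, multAt, Int.toNat_of_nonneg h0]

/-- **`Φ₀(Grp/Grp) ≅ ℕ`** at the v2 model of record: one orbit of prime log-divisors (Rmk. 3.3.1).
[cite: MochizukiEtTh2009, Rmk 3.3.1 p.73] -/
def phiZeroPtEquivNat : act.phiZero (gset pt) ≃* Multiplicative ℕ where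
  toFun φ := Multiplicative.ofAdd (multAt φ)
  invFun n := constPhi (Multiplicative.toAdd n)
  left_inv φ := by
    change constPhi (Multiplicative.toAdd (Multiplicative.ofAdd (multAt φ))) = φ
    rw [toAdd_ofAdd]
    exact (eq_constPhi_multAt φ).symm
  right_inv n := by
    change Multiplicative.ofAdd (Int.toNat (val (constDIV ((Multiplicative.toAdd n : ℕ) : ℤ)) (Sum.inr (0 : ℤ)))) = n
    rw [val_constDIV, Int.toNat_natCast, ofAdd_toAdd]
  map_mul' φ ψ := by
    rw [← ofAdd_add]
    congr 1
    have hφ : (0 : ℤ) ≤ val (φ.1 s₀) (Sum.inr 0) := (φ.2.1 s₀).2 _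
    have hψ : (0 : ℤ) ≤ val (ψ.1 s₀) (Sum.inr 0) := (ψ.2.1 s₀).2 _
    change Int.toNat (val (φ.1 s₀) (Sum.inr 0) + val (ψ.1 s₀) (Sum.inr 0)) = _
    rw [Int.toNat_add hφ hψ]
    rfl

/-! ### `n·Σ_j [F_j] = div₀(ϖⁿ)`: the rank-one object -/

/-- The constant function `ϖ^c` on the point `Grp/Grp` (shear-invariant), an element of `B₀(Grp/Grp)`.
[cite: MochizukiEtTh2009, Def 3.3 p.73] -/
def cnstFn (c : ℤ) : act.bZero (gset pt) :=
  ⟨fun _ => Multiplicative.ofAdd ((c, 0) : ℤ × ℤ), fun _ => trivial, fun g _ => by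
    change Multiplicative.ofAdd ((c, 0) : ℤ × ℤ) = shearFn (Multiplicative.toAdd g.1) (Multiplicative.ofAdd ((c, 0) : ℤ × ℤ))
    rw [shearFn_const]⟩

/-- `ϖ^c` is a constant (lies in `F₀(Grp/Grp)`). [cite: MochizukiEtTh2009, Def 3.3 p.73] -/
theorem cnstFn_mem_fZero (c : ℤ) : cnstFn c ∈ act.fZero (gset pt) := fun _ => ofAdd_const_mem_const c

/-- `div₀(ϖⁿ) = n·Σ_j [F_j]` at the v2 model of record (`div₀ = divZeroHom` at the level of `pt`, definitionally).
[cite: MochizukiEtTh2009, Def 3.3 p.73] -/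
theorem div₀_cnstFn (n : ℕ) :
    act.divZeroHom (gset pt) (cnstFn n) =
      Algebra.GrothendieckGroup.of (constPhi n : (DivisorMonoids.ofTower tower).Φ₀.obj (op pt)) :=
  ((act.divZeroHom_eq_div_iff _ _ (constPhi n) 1).2 fun s => by
    change act.divAt (gset pt) (cnstFn n) s * 1 = constDIV (n : ℤ)
    rw [mul_one]
    refine Multiplicative.toAdd.injective (funext fun x => ?_)
    change Multiplicative.toAdd (divHom (Multiplicative.ofAdd (((n : ℤ), 0) : ℤ × ℤ))) x = val (constDIV (n : ℤ)) x
    rw [toAdd_divHom, toAdd_ofAdd, val_constDIV]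
    simp).trans (by simp only [map_one, div_one])

/-- **The base point `Grp/Grp` is a RANK-ONE OBJECT of the v2 model of record** (`Φ₀ ≅ ℕ`, every log-divisor the divisor of a
power of the uniformiser). [cite: MochizukiEtTh2009, Def 3.3 p.73] -/
def rankOneObject : (DivisorMonoids.ofTower tower).RankOneObject where
  Y₀ := pt
  e := phiZeroPtEquivNat
  hcnst m := ⟨cnstFn (multAt m), cnstFn_mem_fZero _,
    (div₀_cnstFn (multAt m)).trans (congrArg Algebra.GrothendieckGroup.of (eq_constPhi_multAt m)).symm⟩

/-! ### The tempered Frobenioid over the v2 model of record -/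

variable (R S : ((Discrete PUnit.{1})ᵒᵖ ⥤ CommMonCat.{0}) → Prop)

/-- **A tempered Frobenioid (Def. 3.6 (ii), weak vocabulary of record, monoid type `ℤ`) over the v2 MODEL OF RECORD** — the
Kummer–Tate tower's Def. 3.3 (iii) data with covering-indexed `Mero` — at its base point: abc-iut-w5-d179's `dm`-generic rank-one
engine at `rankOneObject`; every condition PROVED (the `p`-adic Frobenioid of the base field of the Tate curve).
[cite: MochizukiEtTh2009, Def 3.6 p.77] -/
def temperedFrobenioid :
    TemperedFrobenioid (RealifiedDivisorMonoids.ofRlfZWeak (DivisorMonoids.ofTower tower) hpf) (Discrete PUnit.{1})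
      (treeCatVocab (Discrete PUnit.{1}) R S) :=
  TemperedFrobenioid.ofRankOneObject rankOneObject hpf R S

/-- **NON-VACUITY at the v2 model of record**: «for every tempered Frobenioid over `ofRlfZWeak (ofTower tower) hpf`» quantifies over
an inhabited class. [cite: MochizukiEtTh2009, Def 3.6 p.77] -/
theorem nonempty_temperedFrobenioid_ofTower :
    Nonempty (TemperedFrobenioid (RealifiedDivisorMonoids.ofRlfZWeak (DivisorMonoids.ofTower tower) hpf) (Discrete PUnit.{1})
      (treeCatVocab (Discrete PUnit.{1}) R S)) :=
  ⟨temperedFrobenioid R S⟩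

/-- **«`C` is a Frobenioid» at the v2 model of record** ([FrdI] Thm. 5.2 (ii), via the engine). [cite: MochizukiFrdI2008, Thm. 5.2 (ii) p.100] -/
theorem isFrobenioid_temperedFrobenioid : PreFrobenioid.IsFrobenioid (temperedFrobenioid R S).toElem :=
  TemperedFrobenioid.isFrobenioid_ofRankOneObject rankOneObject hpf R S

/-- `Φ` of the witness is `im(Φ₀(pt)^pf → Φ₀(pt)^rlf)` (print's choice of `Φ`, Ex. 3.9 (iii)). [cite: MochizukiEtTh2009, Def 3.6 p.77] -/
theorem temperedFrobenioid_Φ_carrier (X : (Discrete PUnit.{1})ᵒᵖ) :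
    (temperedFrobenioid R S).Φ.carrier X = rankOneObject.pfImage hpf := rfl

variable (Γ : Type) [Group Γ] [TopologicalSpace Γ] (R' S' : ((ConnectedPart (BTemp Γ))ᵒᵖ ⥤ CommMonCat.{0}) → Prop)

/-- **… and re-based over print's GENUINE base `B^temp(Π)⁰` for EVERY topological group `Π`** (the engine's
`ofRankOneObjectConnectedPart`). [cite: MochizukiEtTh2009, Def 3.6 p.77] -/
theorem nonempty_temperedFrobenioid_ofTower_connectedPart :
    Nonempty (TemperedFrobenioid (RealifiedDivisorMonoids.ofRlfZWeak (DivisorMonoids.ofTower tower) hpf)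
      (ConnectedPart (BTemp Γ)) (treeCatVocab (ConnectedPart (BTemp Γ)) R' S')) :=
  ⟨TemperedFrobenioid.ofRankOneObjectConnectedPart rankOneObject hpf (fun _ => True) (fun _ => True) Γ R' S'⟩

end TateTowerKummer

end Literature.AnabelianGeometry.EtaleTheta

end
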